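import Summits.Ventures.PercRepro.RankLevelSetDepCountHeavyWin
import Summits.Ventures.PercRepro.RankLevelSetHeavyWindowFactor
import Summits.Ventures.PercRepro.RankLevelSetLevelSixTailLevels
import Summits.Ventures.PercRepro.RankLevelSetLevelSixHeavyCell
import Summits.Ventures.PercRepro.RankLevelSetDepCountHeavySq
import Summits.Ventures.PercRepro.RankLevelSetDepCountHeavyCap
import Summits.Ventures.PercRepro.RankLevelSetMultFifteenCount
import Summits.Ventures.PercRepro.RankLevelSetMultCubeCount
import Summits.Ventures.PercRepro.RankLevelSetCoreCircuitBounds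
import Summits.Ventures.PercRepro.RankLevelSetLevelSix
import Summits.Ventures.PercRepro.S1FourCircuitCount
import Summits.Ventures.PercRepro.RankLevelSetPlaneSix
import Summits.Ventures.PercRepro.S1TriangleCount
import Summits.Ventures.PercRepro.RankLevelSetTriangleStar
import Summits.Ventures.PercRepro.RankLevelSetCorankFiveCounts
import Summits.Ventures.PercRepro.RankLevelSetPlaneTen
import Summits.Ventures.PercRepro.RankLevelSetPlaneTenPrime
import Summits.Ventures.PercRepro.S1TrianglePlusPlus
import Summits.Ventures.PercRepro.RankLevelSetLowRankCount
import Summits.Ventures.PercRepro.RankLevelSetDepCountHeavyU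
import Summits.Ventures.PercRepro.RankLevelSetCoreFour
import Summits.Ventures.PercRepro.RankLevelSetFrameLarge
import Summits.Ventures.PercRepro.RankLevelSetFrameQM
import Summits.Ventures.PercRepro.RankLevelSetLevelFiveAll
import Summits.Ventures.PercRepro.RankLevelSetLevelSixGiant
import Summits.Ventures.PercRepro.RankLevelSetCoreSixColoopFree
import Summits.Ventures.PercRepro.RankLevelSetLevelSixIndepMono
import Summits.Ventures.PercRepro.RankLevelSetTopCountCoindep
import Summits.Ventures.PercRepro.RankLevelSetMultCubeCountCoindep

/-!
# PercRepro — THE LEVEL-`6` CELL `sq27di2v` WITH TWO TRIANGLES: THE `6`-SET TERM `C(n, 6) − C(n − 6, 6)` (p8 g12, S3)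

`proofs/SUBCLAIM-S3-p8.md` §3y. `c025_core_six_heavy_cell_sq27di2u` (RankLevelSetLevelSixHeavyCellSq27DI2U, p8 g10) word
for word, with the third heavy term `(p + d)·Σ_{5 ≤ i ≤ c − 1} C(uH, i)` of `hpoly` / `htail` replaced by
`(p + d − uH)·Σ_{5 ≤ i ≤ c − 1} C(uH, i)`: the extra point of a heavy set `B ⊆ insert x UH`, `B ⊄ UH`, lies outside `UH`
(`ncard_heavy_le_cap_window_factor`, RankLevelSetHeavyWindowFactor), and `(n − |UH|)·Σ C(|UH|, i)` is monotone in
`|UH| ≤ uH` under the new side condition `huH5 : uH ≤ 5·(p + d + 1 − uH)` (`window_mul_mono`). Nothing else changes.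
Axioms: standard.
-/

open scoped Matroid

namespace PercRepro

namespace ThmN

open Set

variable {α : Type}

set_option maxHeartbeats 800000 in
/-- **THE CELL `sq27di2v` WITH TWO DISTINCT TRIANGLES (`d ≤ 7`)**: `c025_core_six_heavy_cell_sq27di2v` with the independent-`6`-set term `C(p + d, 6) + C(c₃, 2)(p + d − 5) − c₃·C(p + d − 3, 3)` of `hpoly` replaced by `C(p + d, 6) − C(p + d − 6, 6)` — every coindependent `6`-set meets `C₁ ∪ C₂` (THE CONFINEMENT LEMMA); conclusion `Φ·#U(p, 6) ≤ #Y(p, 6)`. -/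
theorem c025_core_six_heavy_cell_sq27di2v_twotri (M : Matroid α) [M.Finite] (p d ν₁ uG uH b Kn Kd a c5 c4 c3 c6 c7 D : ℕ)
    (hD : 0 < D) (Φ : ℚ) (hΦ : Φ ≤ (2 : ℚ) ^ (p + 6) / (D : ℚ)) (hd7 : 7 ≤ d) (_hp7 : 7 ≤ p)
    (_hν7 : 7 ≤ ν₁) (hUG : (Matroid.UG M 6 ν₁).ncard ≤ uG) (hUH : (Matroid.UH M 6 ν₁).ncard ≤ uH)
    (huH5 : uH ≤ 5 * (p + d + 1 - uH))
    (hb : 6 + ν₁ ≤ min 19 (5 + d) + 2 ∨ b = 1) (hK : Kd < Kn) (hKd : 0 < Kd) (ha : min 39 (6 + d) ≤ a)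
    (hs3 : {C | M.IsCircuit C ∧ C.ncard = 3}.ncard ≤ c3) (hs4 : {C | M.IsCircuit C ∧ C.ncard = 4}.ncard ≤ c4)
    (hs5 : {C | M.IsCircuit C ∧ C.ncard = 5}.ncard ≤ c5)
    (hs6 : {C | M.IsCircuit C ∧ C.ncard = 6}.ncard ≤ c6) (hs7 : {C | M.IsCircuit C ∧ C.ncard = 7}.ncard ≤ c7)
    (htail : ((Kn : ℚ) * (((∑ j ∈ Finset.range (3 + 1), (((p + d).choose j : ℕ) : ℚ)) +
        (((p + d).choose 3 : ℚ) +
        ((∑ j ∈ Finset.range (min 6 (3 + d) - (3 + 1) + 1),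
        ((min (3 - 3) (4 - 2)).choose j : ℚ) * (2 / ((Matroid.mult15 (j + 1) : ℕ) : ℚ))) +
        (∑ j ∈ Finset.range (min 6 (3 + d) - (3 + 1) + 1),
        ((4 - 2).choose j : ℚ) * (2 / ((Matroid.mult15 (j + 1) : ℕ) : ℚ)))) *
        ((c3 : ℚ) * ((((p + d) - 3).choose 1 : ℕ) : ℚ) + (c4 : ℚ) * ((((p + d) - 4).choose 0 : ℕ) : ℚ))) +
        (((p + d).choose 4 : ℚ) +
        ((∑ j ∈ Finset.range (min 10 (4 + d) - (4 + 1) + 1),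
        ((min (min 6 (3 + d) - 4) (7 - 2)).choose j : ℚ) * (2 / ((Matroid.mult15 (j + 1) : ℕ) : ℚ))) +
        (∑ j ∈ Finset.range (min 10 (4 + d) - (4 + 1) + 1),
        ((7 - 2).choose j : ℚ) * (2 / ((Matroid.mult15 (j + 1) : ℕ) : ℚ)))) *
        ((c3 : ℚ) * ((((p + d) - 3).choose 2 : ℕ) : ℚ) + (c4 : ℚ) * ((((p + d) - 4).choose 1 : ℕ) : ℚ) +
        (((d + 4).choose 5 : ℕ) : ℚ) * ((((p + d) - 5).choose 0 : ℕ) : ℚ))) +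
        (((p + d).choose 5 : ℚ) +
        ((∑ j ∈ Finset.range (min 19 (5 + d) - (5 + 1) + 1),
        ((min (min 10 (4 + d) - 5) (15 - 2)).choose j : ℚ) * (2 / ((Matroid.mult15 (j + 1) : ℕ) : ℚ))) +
        (∑ j ∈ Finset.range (min 19 (5 + d) - (5 + 1) + 1),
        ((15 - 2).choose j : ℚ) * (2 / ((Matroid.mult15 (j + 1) : ℕ) : ℚ)))) *
        ((c3 : ℚ) * ((((p + d) - 3).choose 3 : ℕ) : ℚ) + (c4 : ℚ) * ((((p + d) - 4).choose 2 : ℕ) : ℚ) +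
        (((d + 4).choose 5 : ℕ) : ℚ) * ((((p + d) - 5).choose 1 : ℕ) : ℚ) +
        (((d + 5).choose 6 : ℕ) : ℚ) * ((((p + d) - 6).choose 0 : ℕ) : ℚ)))) +
        ((((p + d).choose 6 : ℕ) : ℚ) +
          ((∑ i ∈ Finset.range (min 39 (6 + d) - 7 + 1), ((Nat.choose (min (min 19 (5 + d) - 6) (ν₁ - 2)) i : ℕ) : ℚ) * (1 / ((((i + 1) * ((i + 1) ^ 2 + 1) / 2 : ℕ) : ℚ)))) *
            (((c3 : ℕ) : ℚ) * ((p + d - 3).choose 4 : ℚ) + ((c4 : ℕ) : ℚ) * ((p + d - 4).choose 3 : ℚ) +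
          ((c5 : ℕ) : ℚ) * ((p + d - 5).choose 2 : ℚ) + ((c6 : ℕ) : ℚ) * ((p + d - 6 : ℕ) : ℚ) +
          ((c7 : ℕ) : ℚ)) +
          ((b : ℕ) : ℚ) * (∑ i ∈ Finset.range (min 39 (6 + d) - 7 + 1), ((Nat.choose (ν₁ - 2) i : ℕ) : ℚ) * (1 / ((((i + 1) * ((i + 1) ^ 2 + 1) / 2 : ℕ) : ℚ)))) *
            (((c3 : ℕ) : ℚ) * ((p + d - 3).choose 4 : ℚ) + ((c4 : ℕ) : ℚ) * ((p + d - 4).choose 3 : ℚ) +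
          ((c5 : ℕ) : ℚ) * ((p + d - 5).choose 2 : ℚ) + ((c6 : ℕ) : ℚ) * ((p + d - 6 : ℕ) : ℚ) +
          ((c7 : ℕ) : ℚ)) +
          (∑ i ∈ Finset.Icc 6 (min 39 (6 + d)), ((Nat.choose uG i : ℕ) : ℚ)) +
          ((∑ i ∈ Finset.Icc 6 (min 39 (6 + d)), ((Nat.choose uH i : ℕ) : ℚ)) +
            ((p + d - uH : ℕ) : ℚ) * (∑ i ∈ Finset.Icc 5 (min 39 (6 + d) - 1), ((Nat.choose uH i : ℕ) : ℚ))))) +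
        (∑ j ∈ Finset.range (d + 1), (((p + d).choose j : ℕ) : ℚ))) ≤ Kd * 2 ^ (p + d)) ∨
      Kn * (∑ j ∈ Finset.range (a + 1), (p + d).choose j + ∑ j ∈ Finset.range (d + 1), (p + d).choose j) ≤
        Kd * 2 ^ (p + d))
    (hR : M.eRank = (p : ℕ∞)) (hn : M.E.ncard = p + d)
    (hfree : ∀ e ∈ M.E, ∃ A ⊆ M.E \ {e}, e ∉ M.closure A ∧ e ∉ M.closure ((M.E \ {e}) \ A))
    (hdle : d ≤ 7)
    (htwo : ∃ C₁ C₂ : Set α, M.IsCircuit C₁ ∧ M.IsCircuit C₂ ∧ C₁.ncard = 3 ∧ C₂.ncard = 3 ∧ C₁ ≠ C₂)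
    (hpoly : (Kn : ℚ) * ((((p + d).choose 6 : ℕ) : ℚ) + ((0 - (((p + d - 6).choose 6 : ℕ) : ℚ)) +
      ((∑ i ∈ Finset.range (d - 7 + 1), ((Nat.choose (min (min 19 (5 + d) - 6) (ν₁ - 2)) i : ℕ) : ℚ) * (1 / ((((i + 1) * ((i + 1) ^ 2 + 1) / 2 : ℕ) : ℚ)))) *
        (((c3 : ℕ) : ℚ) * ((p + d - 3).choose 4 : ℚ) + ((c4 : ℕ) : ℚ) * ((p + d - 4).choose 3 : ℚ) +
          ((c5 : ℕ) : ℚ) * ((p + d - 5).choose 2 : ℚ) + ((c6 : ℕ) : ℚ) * ((p + d - 6 : ℕ) : ℚ) +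
          ((c7 : ℕ) : ℚ)) +
      ((b : ℕ) : ℚ) * (∑ i ∈ Finset.range (d - 7 + 1), ((Nat.choose (ν₁ - 2) i : ℕ) : ℚ) * (1 / ((((i + 1) * ((i + 1) ^ 2 + 1) / 2 : ℕ) : ℚ)))) *
        (((c3 : ℕ) : ℚ) * ((p + d - 3).choose 4 : ℚ) + ((c4 : ℕ) : ℚ) * ((p + d - 4).choose 3 : ℚ) +
          ((c5 : ℕ) : ℚ) * ((p + d - 5).choose 2 : ℚ) + ((c6 : ℕ) : ℚ) * ((p + d - 6 : ℕ) : ℚ) +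
          ((c7 : ℕ) : ℚ)) +
      (∑ i ∈ Finset.Icc 6 d, ((Nat.choose uG i : ℕ) : ℚ)) +
          ((∑ i ∈ Finset.Icc 6 d, ((Nat.choose uH i : ℕ) : ℚ)) +
            ((p + d - uH : ℕ) : ℚ) * (∑ i ∈ Finset.Icc 5 (d - 1), ((Nat.choose uH i : ℕ) : ℚ)))))) ≤
      ((Kn - Kd : ℕ) : ℚ) * 2 ^ (d - 6) * (D : ℚ)) :
    Φ * (Matroid.topCount M p 6 : ℚ) ≤ (Matroid.midCount M p 6 : ℚ) := by
  classical
  have hEcard : M.ground_finite.toFinset.card = p + d := by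
    rw [← Set.ncard_eq_toFinset_card _ M.ground_finite]; exact hn
  -- the core is simple: every circuit has `≥ 3` elements
  have hL : ∀ e ∈ M.E, ¬ M.IsLoop e := not_isLoop_of_free M hfree
  have hs : ∀ e ∈ M.E, ∀ f ∈ M.E, e ≠ f → M.eRk {e, f} = 2 := by
    intro e he f hf hef
    have h2 : (2 : ℕ∞) ≤ M.eRk {e, f} :=
      two_le_eRk_of_two_le_ncard_of_free M hfree (pair_subset he hf) (by rw [ncard_pair hef])
    have h3 : M.eRk {e, f} ≤ 2 := by have := M.eRk_le_encard {e, f}; rwa [encard_pair hef] at this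
    exact le_antisymm h3 h2
  have hcirc : ∀ C, M.IsCircuit C → 3 ≤ C.encard := three_le_encard_of_circuit M hL hs
  have hC1 : ∀ L ⊆ M.E, M.eRk L = 2 → L.ncard ≤ 3 :=
    fun L hL hr => ncard_le_three_of_eRk_two M hs hfree hL hr
  have hd : M.E.encard = M.eRank + d := by
    rw [hR, ← M.ground_finite.cast_ncard_eq, hn]
    push_cast; ring
  -- the nullity cap: every `X ⊆ E` has `|X| ≤ r(X) + d`
  have hcap : ∀ X ⊆ M.E, ∀ k : ℕ, M.eRk X ≤ k → X.ncard ≤ k + d := by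
    intro X hX k hr
    have h1 := Matroid.encard_le_eRk_add_of_encard_eq hX hd
    have h2 : X.encard ≤ (k : ℕ∞) + d := h1.trans (by gcongr)
    have hfin : X.Finite := M.ground_finite.subset hX
    rw [← hfin.cast_ncard_eq] at h2; exact_mod_cast h2
  have hflat : ∀ X ⊆ M.E, M.eRk X ≤ 6 → X.ncard ≤ min 39 (6 + d) :=
    fun X hX hr => le_min (ncard_le_thirtynine_of_eRk_le_six_of_free M hfree hX hr) (hcap X hX 6 hr)
  have hflat' : ∀ X ⊆ M.E, M.eRk X ≤ ((6 - 1 : ℕ) : ℕ∞) → X.ncard ≤ min 19 (5 + d) :=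
    fun X hX hr => le_min (ncard_le_nineteen_of_eRk_le_five_of_free M hfree hX (by simpa using hr))
      (hcap X hX 5 (by simpa using hr))
  -- (U): the heavy / light count with the size-capped heavy term
  have hU1 := Matroid.topCount_le_ncard_compl (M := M) hR hd 6
  have hG := Matroid.ncard_eRk_eq_ncard_le_le_heavy_cube_cap_indep M 6 (min 19 (5 + d)) ν₁ (by norm_num) hcirc hC1 d
  -- the pair classes, by the DISJOINT pair count
  have hPs : (((Matroid.pairsLight M 6 ν₁).filter (fun p => p ∈ Matroid.pairsSmall M 6 (min 19 (5 + d)))).card : ℚ) ≤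
      ∑ k ∈ Finset.Icc 3 (6 + 1), ({C | M.IsCircuit C ∧ C.ncard = k}.ncard : ℚ) * (((M.E.ncard - k).choose (6 + 1 - k) : ℕ) : ℚ) := by
    have h1 := (Matroid.card_pairsLightSmall_le (M := M) 6 (min 19 (5 + d)) ν₁).trans (Matroid.card_pairsF_le_disj 6)
    have : ((((Matroid.pairsLight M 6 ν₁).filter (fun p => p ∈ Matroid.pairsSmall M 6 (min 19 (5 + d)))).card : ℕ) : ℚ) ≤
        ((∑ k ∈ Finset.Icc 3 (6 + 1), {C | M.IsCircuit C ∧ C.ncard = k}.ncard * (M.E.ncard - k).choose (6 + 1 - k) : ℕ) : ℚ) := by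
      exact_mod_cast h1
    push_cast at this; exact this
  have hPb : (((Matroid.pairsLight M 6 ν₁).filter (fun p => p ∉ Matroid.pairsSmall M 6 (min 19 (5 + d)))).card : ℚ) ≤
      ((b : ℕ) : ℚ) * ∑ k ∈ Finset.Icc 3 (6 + 1), ({C | M.IsCircuit C ∧ C.ncard = k}.ncard : ℚ) * (((M.E.ncard - k).choose (6 + 1 - k) : ℕ) : ℚ) := by
    rcases hb with hb0 | hb1
    · rw [Matroid.card_pairsBigLight_eq_zero 6 (min 19 (5 + d)) ν₁ hb0]
      have : (0 : ℚ) ≤ ((b : ℕ) : ℚ) * ∑ k ∈ Finset.Icc 3 (6 + 1), ({C | M.IsCircuit C ∧ C.ncard = k}.ncard : ℚ) *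
          (((M.E.ncard - k).choose (6 + 1 - k) : ℕ) : ℚ) := by positivity
      simpa using this
    · rw [hb1]; push_cast; rw [one_mul]
      have h1 := (Matroid.card_pairsBigLight_le (M := M) 6 (min 19 (5 + d)) ν₁).trans (Matroid.card_pairsF_le_disj 6)
      have : ((((Matroid.pairsLight M 6 ν₁).filter (fun p => p ∉ Matroid.pairsSmall M 6 (min 19 (5 + d)))).card : ℕ) : ℚ) ≤
          ((∑ k ∈ Finset.Icc 3 (6 + 1), {C | M.IsCircuit C ∧ C.ncard = k}.ncard * (M.E.ncard - k).choose (6 + 1 - k) : ℕ) : ℚ) := by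
        exact_mod_cast h1
      push_cast at this; exact this
  -- the size-capped heavy count at any cap `c`
  have hHvc : ∀ c : ℕ, ({B : Set α | B ⊆ M.E ∧ M.eRk B = (6 : ℕ) ∧ 6 + ν₁ ≤ (M.closure B).ncard ∧ B.ncard ≤ c}.ncard : ℚ) ≤
      (∑ i ∈ Finset.Icc 6 c, ((Nat.choose uG i : ℕ) : ℚ)) +
        ((∑ i ∈ Finset.Icc 6 c, ((Nat.choose uH i : ℕ) : ℚ)) +
          ((p + d - uH : ℕ) : ℚ) * (∑ i ∈ Finset.Icc 5 (c - 1), ((Nat.choose uH i : ℕ) : ℚ))) := by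
    intro c
    have h1 := Matroid.ncard_heavy_le_cap_window_factor (M := M) 6 ν₁ c
    have hmono := Matroid.window_mul_mono (p + d) 5 (c - 1) (Matroid.UH M 6 ν₁).ncard uH (le_refl 5) hUH huH5
    have h2 : ∑ i ∈ Finset.Icc 6 c, (Matroid.UG M 6 ν₁).ncard.choose i +
        (∑ i ∈ Finset.Icc 6 c, (Matroid.UH M 6 ν₁).ncard.choose i +
          (M.E.ncard - (Matroid.UH M 6 ν₁).ncard) * ∑ i ∈ Finset.Icc (6 - 1) (c - 1), (Matroid.UH M 6 ν₁).ncard.choose i) ≤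
        ∑ i ∈ Finset.Icc 6 c, uG.choose i + (∑ i ∈ Finset.Icc 6 c, uH.choose i +
          (p + d - uH) * ∑ i ∈ Finset.Icc 5 (c - 1), uH.choose i) := by
      rw [hn, show (6 : ℕ) - 1 = 5 from rfl]
      exact Nat.add_le_add (Finset.sum_le_sum (fun i _ => Nat.choose_le_choose i hUG))
        (Nat.add_le_add (Finset.sum_le_sum (fun i _ => Nat.choose_le_choose i hUH)) hmono)
    exact_mod_cast h1.trans h2
  have hHv := hHvc d
  have hs3q : ({C | M.IsCircuit C ∧ C.ncard = 3}.ncard : ℚ) ≤ ((c3 : ℕ) : ℚ) := by exact_mod_cast hs3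
  have hs4q : ({C | M.IsCircuit C ∧ C.ncard = 4}.ncard : ℚ) ≤ ((c4 : ℕ) : ℚ) := by exact_mod_cast hs4
  have hs5q : ({C | M.IsCircuit C ∧ C.ncard = 5}.ncard : ℚ) ≤ ((c5 : ℕ) : ℚ) := by exact_mod_cast hs5
  have hs6q : ({C | M.IsCircuit C ∧ C.ncard = 6}.ncard : ℚ) ≤ ((c6 : ℕ) : ℚ) := by exact_mod_cast hs6
  have hs7q : ({C | M.IsCircuit C ∧ C.ncard = 7}.ncard : ℚ) ≤ ((c7 : ℕ) : ℚ) := by exact_mod_cast hs7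
  have hPexp : ∑ k ∈ Finset.Icc 3 (6 + 1), ({C | M.IsCircuit C ∧ C.ncard = k}.ncard : ℚ) * (((M.E.ncard - k).choose (6 + 1 - k) : ℕ) : ℚ) ≤
      ((c3 : ℕ) : ℚ) * ((p + d - 3).choose 4 : ℚ) + ((c4 : ℕ) : ℚ) * ((p + d - 4).choose 3 : ℚ) +
          ((c5 : ℕ) : ℚ) * ((p + d - 5).choose 2 : ℚ) + ((c6 : ℕ) : ℚ) * ((p + d - 6 : ℕ) : ℚ) +
          ((c7 : ℕ) : ℚ) := by
    rw [show (6 : ℕ) + 1 = 7 from rfl, sum_Icc_three_seven_q, hn]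
    simp only [show (7 : ℕ) - 3 = 4 from rfl, show (7 : ℕ) - 4 = 3 from rfl, show (7 : ℕ) - 5 = 2 from rfl,
      show (7 : ℕ) - 6 = 1 from rfl, show (7 : ℕ) - 7 = 0 from rfl, Nat.choose_one_right, Nat.choose_zero_right,
      mul_one, Nat.cast_one]
    gcongr
  set Pq := ((c3 : ℕ) : ℚ) * ((p + d - 3).choose 4 : ℚ) + ((c4 : ℕ) : ℚ) * ((p + d - 4).choose 3 : ℚ) +
          ((c5 : ℕ) : ℚ) * ((p + d - 5).choose 2 : ℚ) + ((c6 : ℕ) : ℚ) * ((p + d - 6 : ℕ) : ℚ) +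
          ((c7 : ℕ) : ℚ) with hPq
  have hσ1 : (0 : ℚ) ≤ ∑ i ∈ Finset.range (d - (6 + 1) + 1), ((Nat.choose (min (min 19 (5 + d) - 6) (ν₁ - 2)) i : ℕ) : ℚ) * (1 / ((((i + 1) * ((i + 1) ^ 2 + 1) / 2 : ℕ) : ℚ))) :=
    Finset.sum_nonneg (fun i _ => by positivity)
  have hσ2 : (0 : ℚ) ≤ ∑ i ∈ Finset.range (d - (6 + 1) + 1), ((Nat.choose (ν₁ - 2) i : ℕ) : ℚ) * (1 / ((((i + 1) * ((i + 1) ^ 2 + 1) / 2 : ℕ) : ℚ))) :=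
    Finset.sum_nonneg (fun i _ => by positivity)
  have hUq : (Matroid.topCount M p 6 : ℚ) ≤ (((p + d).choose 6 : ℕ) : ℚ) + ((0 - (((p + d - 6).choose 6 : ℕ) : ℚ)) +
      ((∑ i ∈ Finset.range (d - 7 + 1), ((Nat.choose (min (min 19 (5 + d) - 6) (ν₁ - 2)) i : ℕ) : ℚ) * (1 / ((((i + 1) * ((i + 1) ^ 2 + 1) / 2 : ℕ) : ℚ)))) * Pq +
        ((b : ℕ) : ℚ) * (∑ i ∈ Finset.range (d - 7 + 1), ((Nat.choose (ν₁ - 2) i : ℕ) : ℚ) * (1 / ((((i + 1) * ((i + 1) ^ 2 + 1) / 2 : ℕ) : ℚ)))) * Pq +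
        (∑ i ∈ Finset.Icc 6 d, ((Nat.choose uG i : ℕ) : ℚ)) +
          ((∑ i ∈ Finset.Icc 6 d, ((Nat.choose uH i : ℕ) : ℚ)) +
            ((p + d - uH : ℕ) : ℚ) * (∑ i ∈ Finset.Icc 5 (d - 1), ((Nat.choose uH i : ℕ) : ℚ))))) := by
    obtain ⟨C₁, C₂, h1c, h2c, n1, n2, hne⟩ := htwo
    have h1 : (Matroid.topCount M p 6 : ℚ) ≤
        ({B : Set α | B ⊆ M.E ∧ M.eRk B = 6 ∧ B.ncard ≤ d ∧ M.eRk (M.E \ B) = M.eRank}.ncard : ℚ) := by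
      have h := Matroid.topCount_le_ncard_compl_spanning (M := M) hR hd 6
      rw [← hR] at h
      exact_mod_cast h
    have hG' := Matroid.ncard_eRk_eq_ncard_le_le_heavy_cube_cap_indep_coindep M 6 (min 19 (5 + d)) ν₁ (by norm_num) hcirc hC1 d
    -- the coindependent independent `6`-sets meet `C₁ ∪ C₂`: at most `C(n, 6) − C(n − 6, 6)` of them
    have hS1 : ({B : Set α | B ⊆ M.E ∧ B.ncard = 6 ∧ M.eRk B = 6 ∧ M.eRk (M.E \ B) = M.eRank}.ncard : ℚ) ≤
        (((p + d).choose 6 : ℕ) : ℚ) + (0 - (((p + d - 6).choose 6 : ℕ) : ℚ)) := by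
      have hcnt := Matroid.ncard_indep_six_coindep_add_choose_le_of_two_triangles (M := M) hn h1c h2c hne n1 n2 hdle
      have hsub : {B : Set α | B ⊆ M.E ∧ B.ncard = 6 ∧ M.eRk B = 6 ∧ M.eRk (M.E \ B) = M.eRank} ⊆
          {B : Set α | B ⊆ M.E ∧ B.ncard = 6 ∧ M.eRk (M.E \ B) = (p : ℕ∞)} := by
        rintro B ⟨hBE, hB6, _, hBs⟩
        exact ⟨hBE, hB6, by rw [← hR]; exact hBs⟩
      have hle := Set.ncard_le_ncard hsub (M.ground_finite.finite_subsets.subset (fun B hB => hB.1))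
      have hq : (({B : Set α | B ⊆ M.E ∧ B.ncard = 6 ∧ M.eRk (M.E \ B) = (p : ℕ∞)}.ncard : ℕ) : ℚ) +
          (((p + d - 6).choose 6 : ℕ) : ℚ) ≤ (((p + d).choose 6 : ℕ) : ℚ) := by exact_mod_cast hcnt
      have hleq : (({B : Set α | B ⊆ M.E ∧ B.ncard = 6 ∧ M.eRk B = 6 ∧ M.eRk (M.E \ B) = M.eRank}.ncard : ℕ) : ℚ) ≤
          (({B : Set α | B ⊆ M.E ∧ B.ncard = 6 ∧ M.eRk (M.E \ B) = (p : ℕ∞)}.ncard : ℕ) : ℚ) := by exact_mod_cast hle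
      linarith
    obtain ⟨R, hR'⟩ : ∃ R : ℚ, R = ((c4 : ℕ) : ℚ) * ((p + d - 4).choose 3 : ℚ) + ((c5 : ℕ) : ℚ) * ((p + d - 5).choose 2 : ℚ) +
        ((c6 : ℕ) : ℚ) * ((p + d - 6 : ℕ) : ℚ) + ((c7 : ℕ) : ℚ) := ⟨_, rfl⟩
    have hPexp3 : ∑ k ∈ Finset.Icc 3 (6 + 1), ({C | M.IsCircuit C ∧ C.ncard = k}.ncard : ℚ) * (((M.E.ncard - k).choose (6 + 1 - k) : ℕ) : ℚ) ≤
        ({C | M.IsCircuit C ∧ C.ncard = 3}.ncard : ℚ) * ((p + d - 3).choose 4 : ℚ) + R := by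
      have h : ∑ k ∈ Finset.Icc 3 (6 + 1), ({C | M.IsCircuit C ∧ C.ncard = k}.ncard : ℚ) * (((M.E.ncard - k).choose (6 + 1 - k) : ℕ) : ℚ) ≤
          ({C | M.IsCircuit C ∧ C.ncard = 3}.ncard : ℚ) * ((p + d - 3).choose 4 : ℚ) + ((c4 : ℕ) : ℚ) * ((p + d - 4).choose 3 : ℚ) +
            ((c5 : ℕ) : ℚ) * ((p + d - 5).choose 2 : ℚ) + ((c6 : ℕ) : ℚ) * ((p + d - 6 : ℕ) : ℚ) + ((c7 : ℕ) : ℚ) := by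
        rw [show (6 : ℕ) + 1 = 7 from rfl, sum_Icc_three_seven_q, hn]
        simp only [show (7 : ℕ) - 3 = 4 from rfl, show (7 : ℕ) - 4 = 3 from rfl, show (7 : ℕ) - 5 = 2 from rfl, show (7 : ℕ) - 6 = 1 from rfl,
          show (7 : ℕ) - 7 = 0 from rfl, Nat.choose_one_right, Nat.choose_zero_right, mul_one, Nat.cast_one]
        gcongr
      rw [hR']; linarith [h]
    have hPqR : Pq = ((c3 : ℕ) : ℚ) * ((p + d - 3).choose 4 : ℚ) + R := by rw [hPq, hR']; ring
    have hW : (0 : ℚ) ≤ ((p + d - 3).choose 4 : ℚ) := by positivity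
    have hPexp3' : ∑ k ∈ Finset.Icc 3 (6 + 1), ({C | M.IsCircuit C ∧ C.ncard = k}.ncard : ℚ) * (((M.E.ncard - k).choose (6 + 1 - k) : ℕ) : ℚ) ≤ Pq := by
      have := mul_le_mul_of_nonneg_right hs3q hW
      rw [hPqR]; linarith [hPexp3, this]
    have e1 := mul_le_mul_of_nonneg_left (hPs.trans hPexp3') hσ1
    have e2 := mul_le_mul_of_nonneg_left (hPb.trans (mul_le_mul_of_nonneg_left hPexp3' (by positivity))) hσ2
    simp only [show (6 : ℕ) + 1 = 7 from rfl] at e1 e2 ⊢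
    have h3 := add_le_add (add_le_add (add_le_add hS1 e1) e2) hHv
    refine (h1.trans (hG'.trans (h3.trans (le_of_eq ?_))))
    ring
  -- (Y)
  have hY := Matroid.two_pow_le_midCount_add (M := M) p 6 hR
  have hB := Matroid.ncard_spanning_le (M := M) hd
  rw [hEcard] at hY hB
  -- the crude count of the rank-`≤ 6` sets: all the sets of `≤ a` elements
  have hA : {X : Set α | X ⊆ M.E ∧ M.eRk X ≤ 6}.ncard ≤ ∑ j ∈ Finset.range (a + 1), (p + d).choose j := by
    calc {X : Set α | X ⊆ M.E ∧ M.eRk X ≤ 6}.ncard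
        ≤ {X : Set α | X ⊆ (M.ground_finite.toFinset : Set α) ∧ X.ncard ≤ a}.ncard := by
          apply ncard_le_ncard
          · intro X hX
            exact ⟨by rw [Set.Finite.coe_toFinset]; exact hX.1, (hflat X hX.1 hX.2).trans ha⟩
          · exact (Finset.finite_toSet _).finite_subsets.subset (fun X hX => hX.1)
      _ ≤ ∑ j ∈ Finset.range (a + 1), M.ground_finite.toFinset.card.choose j :=
          ncard_subsets_ncard_le _ a
      _ = ∑ j ∈ Finset.range (a + 1), (p + d).choose j := by rw [hEcard]
  have hAq : ({X : Set α | X ⊆ M.E ∧ M.eRk X ≤ 6}.ncard : ℚ) ≤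
      ∑ j ∈ Finset.range (a + 1), (((p + d).choose j : ℕ) : ℚ) := by exact_mod_cast hA
  -- the tail: the level-by-level form
  have hBq : ({X : Set α | X ⊆ M.E ∧ M.eRk X = M.eRank}.ncard : ℚ) ≤
      ∑ j ∈ Finset.range (d + 1), (((p + d).choose j : ℕ) : ℚ) := by exact_mod_cast hB
  -- the rank-`6` sets through the heavy / light count of ALL of them (size cap `min 39 (6 + d)`, windowed heavy term)
  have hG6 := Matroid.ncard_eRk_eq_ncard_le_le_heavy_cube_cap M 6 (min 19 (5 + d)) ν₁ (by norm_num) hcirc hC1 (min 39 (6 + d))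
  have hHv6 := hHvc (min 39 (6 + d))
  have hsub6 : {X : Set α | X ⊆ M.E ∧ M.eRk X = 6}.ncard ≤
      {B : Set α | B ⊆ M.E ∧ M.eRk B = 6 ∧ B.ncard ≤ min 39 (6 + d)}.ncard := by
    apply ncard_le_ncard
    · intro X hX
      exact ⟨hX.1, hX.2, hflat X hX.1 hX.2.le⟩
    · exact M.ground_finite.finite_subsets.subset (fun X hX => hX.1)
  have hU6q : ({X : Set α | X ⊆ M.E ∧ M.eRk X = 6}.ncard : ℚ) ≤ ((p + d).choose 6 : ℚ) +
      ((∑ i ∈ Finset.range (min 39 (6 + d) - 7 + 1), ((Nat.choose (min (min 19 (5 + d) - 6) (ν₁ - 2)) i : ℕ) : ℚ) * (1 / ((((i + 1) * ((i + 1) ^ 2 + 1) / 2 : ℕ) : ℚ)))) * Pq +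
        ((b : ℕ) : ℚ) * (∑ i ∈ Finset.range (min 39 (6 + d) - 7 + 1), ((Nat.choose (ν₁ - 2) i : ℕ) : ℚ) * (1 / ((((i + 1) * ((i + 1) ^ 2 + 1) / 2 : ℕ) : ℚ)))) * Pq +
        (∑ i ∈ Finset.Icc 6 (min 39 (6 + d)), ((Nat.choose uG i : ℕ) : ℚ)) +
          ((∑ i ∈ Finset.Icc 6 (min 39 (6 + d)), ((Nat.choose uH i : ℕ) : ℚ)) +
            ((p + d - uH : ℕ) : ℚ) * (∑ i ∈ Finset.Icc 5 (min 39 (6 + d) - 1), ((Nat.choose uH i : ℕ) : ℚ)))) := by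
    have h1 : ({X : Set α | X ⊆ M.E ∧ M.eRk X = 6}.ncard : ℚ) ≤
        ({B : Set α | B ⊆ M.E ∧ M.eRk B = 6 ∧ B.ncard ≤ min 39 (6 + d)}.ncard : ℚ) := by exact_mod_cast hsub6
    refine h1.trans (hG6.trans ?_)
    have hσ1' : (0 : ℚ) ≤ ∑ i ∈ Finset.range (min 39 (6 + d) - (6 + 1) + 1),
        ((Nat.choose (min (min 19 (5 + d) - 6) (ν₁ - 2)) i : ℕ) : ℚ) * (1 / ((((i + 1) * ((i + 1) ^ 2 + 1) / 2 : ℕ) : ℚ))) :=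
      Finset.sum_nonneg (fun i _ => by positivity)
    have hσ2' : (0 : ℚ) ≤ ∑ i ∈ Finset.range (min 39 (6 + d) - (6 + 1) + 1),
        ((Nat.choose (ν₁ - 2) i : ℕ) : ℚ) * (1 / ((((i + 1) * ((i + 1) ^ 2 + 1) / 2 : ℕ) : ℚ))) :=
      Finset.sum_nonneg (fun i _ => by positivity)
    have e1 := mul_le_mul_of_nonneg_left (hPs.trans hPexp) hσ1'
    have e2 := mul_le_mul_of_nonneg_left (hPb.trans (mul_le_mul_of_nonneg_left hPexp (by positivity))) hσ2'
    simp only [show (6 : ℕ) + 1 = 7 from rfl] at e1 e2 ⊢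
    rw [hn]
    have h3 := add_le_add (add_le_add (add_le_add (le_refl (((p + d).choose 6 : ℕ) : ℚ)) e1) e2) hHv6
    refine h3.trans (le_of_eq ?_)
    ring
  have hA3q : ({X : Set α | X ⊆ M.E ∧ M.eRk X ≤ 6}.ncard : ℚ) ≤
      (((∑ j ∈ Finset.range (3 + 1), (((p + d).choose j : ℕ) : ℚ)) +
        (((p + d).choose 3 : ℚ) +
        ((∑ j ∈ Finset.range (min 6 (3 + d) - (3 + 1) + 1),
        ((min (3 - 3) (4 - 2)).choose j : ℚ) * (2 / ((Matroid.mult15 (j + 1) : ℕ) : ℚ))) +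
        (∑ j ∈ Finset.range (min 6 (3 + d) - (3 + 1) + 1),
        ((4 - 2).choose j : ℚ) * (2 / ((Matroid.mult15 (j + 1) : ℕ) : ℚ)))) *
        ((c3 : ℚ) * ((((p + d) - 3).choose 1 : ℕ) : ℚ) + (c4 : ℚ) * ((((p + d) - 4).choose 0 : ℕ) : ℚ))) +
        (((p + d).choose 4 : ℚ) +
        ((∑ j ∈ Finset.range (min 10 (4 + d) - (4 + 1) + 1),
        ((min (min 6 (3 + d) - 4) (7 - 2)).choose j : ℚ) * (2 / ((Matroid.mult15 (j + 1) : ℕ) : ℚ))) +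
        (∑ j ∈ Finset.range (min 10 (4 + d) - (4 + 1) + 1),
        ((7 - 2).choose j : ℚ) * (2 / ((Matroid.mult15 (j + 1) : ℕ) : ℚ)))) *
        ((c3 : ℚ) * ((((p + d) - 3).choose 2 : ℕ) : ℚ) + (c4 : ℚ) * ((((p + d) - 4).choose 1 : ℕ) : ℚ) +
        (((d + 4).choose 5 : ℕ) : ℚ) * ((((p + d) - 5).choose 0 : ℕ) : ℚ))) +
        (((p + d).choose 5 : ℚ) +
        ((∑ j ∈ Finset.range (min 19 (5 + d) - (5 + 1) + 1),
        ((min (min 10 (4 + d) - 5) (15 - 2)).choose j : ℚ) * (2 / ((Matroid.mult15 (j + 1) : ℕ) : ℚ))) +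
        (∑ j ∈ Finset.range (min 19 (5 + d) - (5 + 1) + 1),
        ((15 - 2).choose j : ℚ) * (2 / ((Matroid.mult15 (j + 1) : ℕ) : ℚ)))) *
        ((c3 : ℚ) * ((((p + d) - 3).choose 3 : ℕ) : ℚ) + (c4 : ℚ) * ((((p + d) - 4).choose 2 : ℕ) : ℚ) +
        (((d + 4).choose 5 : ℕ) : ℚ) * ((((p + d) - 5).choose 1 : ℕ) : ℚ) +
        (((d + 5).choose 6 : ℕ) : ℚ) * ((((p + d) - 6).choose 0 : ℕ) : ℚ)))) +
        ((((p + d).choose 6 : ℚ) +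
          ((∑ i ∈ Finset.range (min 39 (6 + d) - 7 + 1), ((Nat.choose (min (min 19 (5 + d) - 6) (ν₁ - 2)) i : ℕ) : ℚ) * (1 / ((((i + 1) * ((i + 1) ^ 2 + 1) / 2 : ℕ) : ℚ)))) * Pq +
          ((b : ℕ) : ℚ) * (∑ i ∈ Finset.range (min 39 (6 + d) - 7 + 1), ((Nat.choose (ν₁ - 2) i : ℕ) : ℚ) * (1 / ((((i + 1) * ((i + 1) ^ 2 + 1) / 2 : ℕ) : ℚ)))) * Pq +
          (∑ i ∈ Finset.Icc 6 (min 39 (6 + d)), ((Nat.choose uG i : ℕ) : ℚ)) +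
          ((∑ i ∈ Finset.Icc 6 (min 39 (6 + d)), ((Nat.choose uH i : ℕ) : ℚ)) +
            ((p + d - uH : ℕ) : ℚ) * (∑ i ∈ Finset.Icc 5 (min 39 (6 + d) - 1), ((Nat.choose uH i : ℕ) : ℚ))))))) := by
    have hsp := ncard_eRk_le_succ_le M 5
    simp only [show (5 : ℕ) + 1 = 6 from rfl, Nat.cast_ofNat] at hsp
    have hspq : ({X : Set α | X ⊆ M.E ∧ M.eRk X ≤ 6}.ncard : ℚ) ≤
        ({X : Set α | X ⊆ M.E ∧ M.eRk X ≤ 5}.ncard : ℚ) + ({X : Set α | X ⊆ M.E ∧ M.eRk X = 6}.ncard : ℚ) := by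
      exact_mod_cast hsp
    have hT5 := ncard_eRk_le_five_le_levels M d c3 c4 hd hfree hs3 hs4
    rw [hn] at hT5
    linarith [hspq, hT5, hU6q]
  have hKdq : (0 : ℚ) < (Kd : ℚ) := by exact_mod_cast hKd
  have hABq : ((Kn : ℚ) / (Kd : ℚ)) * (({X : Set α | X ⊆ M.E ∧ M.eRk X ≤ 6}.ncard : ℚ) +
      ({X : Set α | X ⊆ M.E ∧ M.eRk X = M.eRank}.ncard : ℚ)) ≤ 2 ^ (p + d) := by
    rw [div_mul_eq_mul_div, div_le_iff₀ hKdq]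
    have hKn0 : (0 : ℚ) ≤ (Kn : ℚ) := Nat.cast_nonneg _
    rcases htail with htail | htail
    · rw [hPq] at hA3q
      have h1 := mul_le_mul_of_nonneg_left (add_le_add hA3q hBq) hKn0
      have h2 : (Kn : ℚ) * (({X : Set α | X ⊆ M.E ∧ M.eRk X ≤ 6}.ncard : ℚ) +
          ({X : Set α | X ⊆ M.E ∧ M.eRk X = M.eRank}.ncard : ℚ)) ≤ (Kd : ℚ) * 2 ^ (p + d) := by
        refine h1.trans (le_trans (le_of_eq ?_) htail)
        ring
      linarith [h2]
    · have ht : (Kn : ℚ) * ((∑ j ∈ Finset.range (a + 1), (((p + d).choose j : ℕ) : ℚ)) +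
          ∑ j ∈ Finset.range (d + 1), (((p + d).choose j : ℕ) : ℚ)) ≤ (Kd : ℚ) * 2 ^ (p + d) := by
        exact_mod_cast htail
      linarith [mul_le_mul_of_nonneg_left (add_le_add hAq hBq) hKn0, ht]
  -- (Φ) and the polynomial inequality
  -- assemble in `ℚ`
  have hYq : (2 : ℚ) ^ (p + d) ≤ (Matroid.midCount M p 6 : ℚ) +
      ({X : Set α | X ⊆ M.E ∧ M.eRk X ≤ 6}.ncard : ℚ) +
      ({X : Set α | X ⊆ M.E ∧ M.eRk X = M.eRank}.ncard : ℚ) := by exact_mod_cast hY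
  have hU0 : (0 : ℚ) ≤ (Matroid.topCount M p 6 : ℚ) := Nat.cast_nonneg _
  have hd6 : 6 ≤ d := by omega
  have hKq : (0 : ℚ) < (Kn : ℚ) / (Kd : ℚ) := by
    apply div_pos _ hKdq
    exact_mod_cast (by omega : 0 < Kn)
  have hLq : ((Kn - Kd : ℕ) : ℚ) / (Kd : ℚ) + 1 = (Kn : ℚ) / (Kd : ℚ) := by
    rw [Nat.cast_sub (by omega : Kd ≤ Kn), div_add_one hKdq.ne']
    ring
  have hpoly' : ((Kn : ℚ) / (Kd : ℚ)) * ((((p + d).choose 6 : ℕ) : ℚ) + ((0 - (((p + d - 6).choose 6 : ℕ) : ℚ)) +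
      ((∑ i ∈ Finset.range (d - 7 + 1), ((Nat.choose (min (min 19 (5 + d) - 6) (ν₁ - 2)) i : ℕ) : ℚ) * (1 / ((((i + 1) * ((i + 1) ^ 2 + 1) / 2 : ℕ) : ℚ)))) * Pq +
        ((b : ℕ) : ℚ) * (∑ i ∈ Finset.range (d - 7 + 1), ((Nat.choose (ν₁ - 2) i : ℕ) : ℚ) * (1 / ((((i + 1) * ((i + 1) ^ 2 + 1) / 2 : ℕ) : ℚ)))) * Pq +
        (∑ i ∈ Finset.Icc 6 d, ((Nat.choose uG i : ℕ) : ℚ)) +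
          ((∑ i ∈ Finset.Icc 6 d, ((Nat.choose uH i : ℕ) : ℚ)) +
            ((p + d - uH : ℕ) : ℚ) * (∑ i ∈ Finset.Icc 5 (d - 1), ((Nat.choose uH i : ℕ) : ℚ)))))) ≤
      (((Kn - Kd : ℕ) : ℚ) / (Kd : ℚ)) * 2 ^ (d - 6) * (D : ℚ) := by
    rw [div_mul_eq_mul_div, div_mul_eq_mul_div, div_mul_eq_mul_div]
    exact div_le_div_of_nonneg_right hpoly hKdq.le
  have hDq : (0 : ℚ) < (D : ℚ) := by exact_mod_cast hD
  exact level_arith_KD (p := p) (d := d) (n := p + d) (q := 6) rfl hd6 hKq hLq hDq hΦ hU0 hUq hYq hABq hpoly'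

end ThmN

end PercRepro
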